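import Mathlib.RingTheory.SimpleModule.Basic
import Mathlib.RingTheory.Adjoin.Basic
import HarnessLib

/-!
# Subspaces stable under a set of operators: transport along semilinear intertwiners, and simplicity over the generated algebra

Topic `Literature/RingTheory/SimpleModule`; namespace `Literature.RingTheory.SimpleModule`.  THEOREMS ONLY (no definition, no named fact, no
instance; Mathlib only).  Written for the cell `hodgecm-mathlib` (D-0151) as the generic half (A1) of the adaptor «the image `f′(ω^K)` of the
`K`-fixed vectors of an irreducible representation under a semilinear Hecke-equivariant map is a SIMPLE module over the algebra generated by the
Hecke operators» ([Liu2021] p. 133 (D.3) `H¹_B(Sh_K, ℂ)[(π^∞)^K]`; [Bump1997] Prop. 4.2.3); nothing here is specific to Hecke algebras.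

The property «`W` has no non-zero proper `k`-subspace stable under every operator of `S`» is spelled out, not named (no definition):
`∀ U : Submodule k V, U ≤ W → (∀ s ∈ S, ∀ u ∈ U, s u ∈ U) → U = ⊥ ∨ U = W`.

* `eq_bot_or_eq_map_of_forall_stable` — TRANSPORT: if `f : V →ₛₗ[σ] V'` is `σ`-semilinear for a surjective `σ : k → k'` (e.g. a field
  isomorphism `ι : ℂ ≃ ℚ_ℓ^{ac}`), `W ≤ V` is `S`-stable with no non-zero proper `S`-stable subspace, and every `s ∈ S` has a partner `s' ∈ S'` with
  `f ∘ s = s' ∘ f` on `W`, then `f(W)` has no non-zero proper `S'`-stable `k'`-subspace (pull a stable `U' ≤ f(W)` back to `W ⊓ f⁻¹ U'`; no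
  injectivity is needed).
* `isAtom_of_forall_stable`, `isSimpleModule_of_forall_stable` — SIMPLICITY: for the subalgebra `R' = k[S] ≤ End_k V` generated by `S` and an
  `R'`-submodule `N ≠ 0` of `V` whose underlying subspace has no non-zero proper `S`-stable subspace, `N` is a simple `R'`-module (an `R'`-submodule is
  an `S`-stable subspace).

[Bump1997] §4.2 Prop. 4.2.3 is the source of the pattern («if `(π, V)` is irreducible then `V^{K}` is a simple `ℋ_K`-module»); the semilinear transport
is the bookkeeping for reading a complex representation inside an `ℓ`-adic one along `ι : ℂ ≅ ℚ̄_ℓ` ([Liu2021] §4.2 l. 2162–2165, `ι_ℓ ∘ ω`).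

## References
* [Bump1997] D. Bump, *Automorphic Forms and Representations* (1997), §4.2 Prop. 4.2.3.
* [Liu2021] Y. Liu, *Fourier–Jacobi cycles and arithmetic relative trace formula*, Camb. J. Math. 9 (2021), §4.2 (FJcycle.tex l. 2162–2165), p. 133 (D.3).
-/

namespace Literature.RingTheory.SimpleModule

/-! ## §1 Transport along a semilinear intertwiner -/

section Transport

variable {k k' V V' : Type*} [Semiring k] [Semiring k'] [AddCommMonoid V] [Module k V] [AddCommMonoid V'] [Module k' V']
  {σ : k →+* k'} [RingHomSurjective σ]

/-- **Transport of «no non-zero proper stable subspace» along a semilinear intertwiner.**  Let `f : V →ₛₗ[σ] V'` be `σ`-semilinear, `W ≤ V`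
stable under the operators of `S` and without non-zero proper `S`-stable subspace, and suppose every `s ∈ S` has a partner `s' ∈ S'` with
`f (s w) = s' (f w)` on `W`.  Then every `S'`-stable subspace of `f(W)` is `⊥` or `f(W)`.
[cite: Bump1997, §4.2 Prop. 4.2.3] [cite: Liu2021, §4.2 (FJcycle.tex l. 2162–2165)] -/
theorem eq_bot_or_eq_map_of_forall_stable (f : V →ₛₗ[σ] V')
    {S : Set (Module.End k V)} {S' : Set (Module.End k' V')} (W : Submodule k V)
    (hWS : ∀ s ∈ S, ∀ w ∈ W, s w ∈ W)
    (hW : ∀ U : Submodule k V, U ≤ W → (∀ s ∈ S, ∀ u ∈ U, s u ∈ U) → U = ⊥ ∨ U = W)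
    (hSS' : ∀ s ∈ S, ∃ s' ∈ S', ∀ w ∈ W, f (s w) = s' (f w))
    (U' : Submodule k' V') (hU'W : U' ≤ W.map f) (hU'S : ∀ s' ∈ S', ∀ u ∈ U', s' u ∈ U') :
    U' = ⊥ ∨ U' = W.map f := by
  -- pull back: `U := W ⊓ f⁻¹ U'`
  set U : Submodule k V := W ⊓ U'.comap f with hUdef
  have hUW : U ≤ W := inf_le_left
  have hUS : ∀ s ∈ S, ∀ u ∈ U, s u ∈ U := by
    intro s hs u hu
    obtain ⟨huW, huU'⟩ := Submodule.mem_inf.1 hu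
    obtain ⟨s', hs', hss'⟩ := hSS' s hs
    refine Submodule.mem_inf.2 ⟨hWS s hs u huW, ?_⟩
    rw [Submodule.mem_comap, hss' u huW]
    exact hU'S s' hs' (f u) (Submodule.mem_comap.1 huU')
  rcases hW U hUW hUS with h | h
  · -- `U = ⊥`: every `u' ∈ U'` is `f w` with `w ∈ U`, hence `0`
    refine Or.inl ((Submodule.eq_bot_iff _).2 fun u' hu' => ?_)
    obtain ⟨w, hw, rfl⟩ := Submodule.mem_map.1 (hU'W hu')
    have hwU : w ∈ U := Submodule.mem_inf.2 ⟨hw, Submodule.mem_comap.2 hu'⟩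
    rw [h, Submodule.mem_bot] at hwU
    rw [hwU, map_zero]
  · -- `U = W`: `f(W) ≤ U'`
    refine Or.inr (le_antisymm hU'W ?_)
    rintro _ ⟨w, hw, rfl⟩
    have hwU : w ∈ U := by rw [h]; exact hw
    exact Submodule.mem_comap.1 (Submodule.mem_inf.1 hwU).2

end Transport

/-! ## §2 Simplicity over the generated algebra -/

section Simple

variable {k V : Type*} [Field k] [AddCommGroup V] [Module k V] (S : Set (Module.End k V))

/-- An `R'`-submodule of `V`, `R' = k[S] ≤ End_k V`, has an underlying `k`-subspace stable under `S` (bookkeeping).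
[cite: Bump1997, §4.2 Prop. 4.2.3] -/
theorem exists_submodule_coe_eq (U : Submodule (Algebra.adjoin k S) V) :
    ∃ U₀ : Submodule k V, (U₀ : Set V) = U ∧ ∀ s ∈ S, ∀ u ∈ U₀, s u ∈ U₀ := by
  refine ⟨{ carrier := U
            add_mem' := fun ha hb => U.add_mem ha hb
            zero_mem' := U.zero_mem
            smul_mem' := fun c u hu => ?_ }, rfl, fun s hs u hu => ?_⟩
  · -- `c • u = (algebraMap k R' c) • u`
    have h := U.smul_mem (algebraMap k (Algebra.adjoin k S) c) hu
    simpa using h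
  · exact U.smul_mem (⟨s, Algebra.subset_adjoin hs⟩ : Algebra.adjoin k S) hu

/-- **Simplicity over the generated algebra.**  Let `R' = k[S] ≤ End_k V` and `N` a non-zero `R'`-submodule of `V` whose underlying subspace has no
non-zero proper `S`-stable `k`-subspace.  Then `N` is an atom of the lattice of `R'`-submodules. [cite: Bump1997, §4.2 Prop. 4.2.3] -/
theorem isAtom_of_forall_stable (N : Submodule (Algebra.adjoin k S) V) (hN0 : N ≠ ⊥)
    (hN : ∀ U : Submodule k V, (U : Set V) ⊆ N → (∀ s ∈ S, ∀ u ∈ U, s u ∈ U) → U = ⊥ ∨ (U : Set V) = N) : IsAtom N := by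
  refine ⟨hN0, fun U hU => ?_⟩
  obtain ⟨U₀, hU₀, hU₀S⟩ := exists_submodule_coe_eq S U
  have hsub : (U₀ : Set V) ⊆ N := by rw [hU₀]; exact hU.le
  rcases hN U₀ hsub hU₀S with h | h
  · refine (Submodule.eq_bot_iff _).2 fun u hu => ?_
    have : u ∈ U₀ := by rw [← SetLike.mem_coe, hU₀]; exact hu
    rw [h, Submodule.mem_bot] at this
    exact this
  · exact absurd (SetLike.coe_injective (hU₀.symm.trans h) : U = N) hU.ne

/-- **… hence `N` is a simple `R'`-module.** [cite: Bump1997, §4.2 Prop. 4.2.3] -/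
theorem isSimpleModule_of_forall_stable (N : Submodule (Algebra.adjoin k S) V) (hN0 : N ≠ ⊥)
    (hN : ∀ U : Submodule k V, (U : Set V) ⊆ N → (∀ s ∈ S, ∀ u ∈ U, s u ∈ U) → U = ⊥ ∨ (U : Set V) = N) :
    IsSimpleModule (Algebra.adjoin k S) N :=
  isSimpleModule_iff_isAtom.2 (isAtom_of_forall_stable S N hN0 hN)

end Simple

end Literature.RingTheory.SimpleModule
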